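import Summits.BirchSwinnertonDyer.BirchSwinnertonDyer.Theorems.TameQuarticManinParityOptimalTwistNeronLattice
import Summits.BirchSwinnertonDyer.BirchSwinnertonDyer.Theorems.TameQuarticManinParityTwistPairManinDivisibilityOfOptimalTwist
import HarnessLib

/-!
# Route `TameQuarticManinParity`, LINE 25 (bsd-idea-3 g8), support M25 `TprimeIrrTwistPairManinDivisibility`
# (stmt-BirchSwinnertonDyer-22695) — PROVED OUTRIGHT, by name: `c_{III*} ∣ c_{III} ∣ 3·c_{III*}` for the optimal Manin
# constants of an irreducible (t′) twist pair at `3`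

Cell `pub/bsd-wall`, D-0145 line `route-BirchSwinnertonDyer-TeichmullerTwistDescent`, seat `bsd-line-ttd-p1` g10.
BSD is NOT proved by this; Manin's conjecture is not proved by this (the divisibilities bound the `3`-adic DIFFERENCE
of the two optimal Manin constants of the pair by one, they do not make either a unit).

## Proof

`tprimeIrrTwistPairManinDivisibility_of_optimalTwistNeronLattice` (GM25 ∘ S25, landed) applied to T24L
(`tprimeIrrOptimalTwistNeronLattice_proof`, proved outright). Design: one composition; no definition, no named fact,
no `sorry`; axioms `propext`, `Classical.choice`, `Quot.sound`.
-/

set_option autoImplicit false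
-- D-0017: single-problem summit, so `Summit.BirchSwinnertonDyer.BirchSwinnertonDyer.…` repeats a namespace BY DESIGN.
set_option linter.dupNamespace false

namespace Summit.BirchSwinnertonDyer.BirchSwinnertonDyer.Theorems.TameQuarticManinParity

open Summit.BirchSwinnertonDyer.BirchSwinnertonDyer.Theses.TameQuarticManinParity

/-- **M25 `TprimeIrrTwistPairManinDivisibility`** (stmt-BirchSwinnertonDyer-22695), OUTRIGHT: `D'.c ∣ D.c ∧ D.c ∣ 3·D'.c`
for the optimal data `D` (type III) and `D'` (twisted newform) of an irreducible (t′) pair.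
[cite: Stevens1989, Lemmas (5.2), (5.4)] -/
theorem tprimeIrrTwistPairManinDivisibility_proof : TprimeIrrTwistPairManinDivisibility :=
  tprimeIrrTwistPairManinDivisibility_of_optimalTwistNeronLattice tprimeIrrOptimalTwistNeronLattice_proof

end Summit.BirchSwinnertonDyer.BirchSwinnertonDyer.Theorems.TameQuarticManinParity
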